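import Summits.QuantumFields.YangMills.Theorems.FluctuationComparisonRegPrIntLS1aAnchorStepContinuousDensity
import Summits.QuantumFields.YangMills.Theorems.FluctuationComparisonRegPrIntLS1aTowerFullWindowMinorant
import Literature.MathematicalPhysics.QuantumFieldTheory.Balaban1983to89.B12ContinuousTransportInvariance
import Literature.MathematicalPhysics.QuantumFieldTheory.Balaban1983to89.Node00.CanonicalTransportOfRecord
import HarnessLib

/-!
# `FluctuationComparisonRegPrIntLS1aTowerOneVersionPWC` — (J1) S1aᴴ `RunClassMembershipH` MINUS {(m), (a)}, BY KERNEL, FOR ONE VERSION: at every height `j₀ ≤ j ≤ K` of every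
# cut-and-anchored tower of every run, ONE density `ρ_j` is (p) STRICTLY POSITIVE on the `θBal F.L γ b₀ p₀ j`-window, (w) a density of the law `μ j`, and (c) continuous on the
# window — indeed continuous EVERYWHERE, measurable, `≥ 0`, with `Node00.regSet dU_j ρ_j = univ`

Cell `ym3-torus` (HUMAN RULING D-0037: rung R3 = continuum SU(2) Yang–Mills on T³ — a RUNG: NOT d = 4, NOT infinite volume, NOT a mass gap, NOT Clay), WIDTH COPY «width 20»
of ym3-torus-p1, seat `ym3-torus-px20` gen 22; `--kind proof --supports stmt-QuantumFields-20520 --as helper` (count-neutral).  THEOREMS ONLY (0 `def`, 0 `sorry`, 0 `instance`,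
0 `notation`, default heartbeats, `autoImplicit false`).  Named by px17 g21 14:31:33Z «(J1) px20 — GO, yours» (the capstone junction of the (c)-at-the-anchor-heights lane
✓p823727 → … → ✓p826128); ★p1's brief «R3's UV-stability node typed with every gap named»: after this file the gap list of `stub_runClassMembershipH` (`Lines/runpair_organ.lean`
:564, conjuncts (p)(w)(m)(c)(a)) is EXACTLY {(m) = the (α) programme + RULING №80's (R-β1′) currency (px8's ✓p824320∕✓`…AlphaAdmissibleSchedule` doors), (a) = (C-an) + (C-size)
(+ (T⊥) where pointwise)} — the three elementary conjuncts hold by kernel, simultaneously, for ONE version, in the stub's own binders.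

INPUTS (all by name).  (w)+(c) at every height: px17 g21's ✓p826128 `…S1aAnchorStepContinuousDensity.exists_continuous_density_tower` (anchor heights: every law of a run has an
everywhere-continuous bounded density, descending induction from the Gibbs law through the full-guard one-step engine ✓p825941; cut heights: px17 g20's ✓p823008 cut-step engine;
its (F4-c) null traces are this seat's ✓p825525).  (p): px21 g22's ✓p821840∕`…S1aTowerFullWindowMinorant.exists_continuous_pos_minorant_fullWindow_sfCut` — a continuous
STRICTLY POSITIVE minorant of EVERY density on the full window (tower sandwich + WREG interior histories).  Junction: an a.e. inequality between functions continuous on the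
(open) window holds EVERYWHERE on it because product Haar charges open sets (lit ✓`B12ContinuousTransportInvariance.isOpenPosMeasure_fieldMeasure_SU`).

CONTENT.
* §1 ★`le_on_open_of_ae_ofReal_le` [folklore] — `μ.IsOpenPosMeasure`, `W` open, `m`, `g` continuous on `W`, `g ≥ 0`, `ofReal (m V) ≤ ofReal (g V)` a.e. ⟹ `m ≤ g` on `W`.
* §2 ★★★`oneVersion_of_towerDoor` — DOOR FORM: from ANY tower (c)-door in `j₀`-first shape + px21's minorant ⟹ the (J1) conclusion.
* §3 ★★`exists_j0_continuous_density_tower` — px17's door with `∃ j₀` moved BEFORE the run system `ν` (the def's order): `j₀` is taken at the CANONICAL runs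
  `ν₀ K j := (D_{j,K})_* Gibbs_K` (lit ✓`descendTo_self`, ✓`descendTo_descendTo`, ✓`descend_eq_descendTo'`) and serves every run system because ✓`run_eq_map_descendTo` pins
  `ν K j` for `j ≤ K` (the tower is modified above `K`, where nothing is read).
* §4 ★★★`runTower_oneVersion_pos_withDensity_continuous (L) (hb : 0 < b₀) (hp : 0 < p₀) : ∃ γ₁ > 0, ∀ F γ, F.L = L → 0 < γ → γ ≤ γ₁ → ∃ j₀, ∀ ν, hν1 → hν2 → ∀ K Ts, Ts ≤ K →
  ∀ μ, hanch → hcut → ∃ ρ, ∀ j (hjK : j ≤ K), j₀ ≤ j → (p) ∧ (w) ∧ (c) ∧ (Continuous ∧ Measurable ∧ ≥ 0 ∧ regSet = univ)` — EVERY `b₀ > 0` (the (m)-lane's schedule may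
  dictate its own `b₀`); ★★★`runClassMembershipH_pwc` — the statement in `RunClassMembershipH`'s LITERAL prefix `∀ L, ∃ pm, … ∀ p₀ ≥ pm, ∃ b₀, ∃ γ₁, ∀ F γ, … ∃ j₀, ∀ ν …,
  ∃ ρ, ∀ j (hjK), j₀ ≤ j → (p) ∧ (w) ∧ (c)` with the (m)∕(a) conjuncts deleted (`pm := 1`, `b₀ := 1`).  The cut hypothesis `hcut` is spelled with the Lines file's `sfCut θ U`
  WRITTEN OUT as its defining product `∏ p, max 0 (min 1 ((24∕25·θ − dist1 U(∂p)) ∕ ((24∕25 − 1∕2)·θ)))` (:262; `rfl` at the junction — Theorems files do not import `Lines/`).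

HONEST FRAMING.  Measure theory of the typed (0.4) averaging + bookkeeping over landed kernel facts; nothing of Bałaban's renormalisation-group analysis is asserted or proved; S1aᴴ's
(m) (AS TYPED misstated by currency — RULING №80 — ∕ AS PRINTED OPEN: the (α) programme) and (a) (`AnalyticPairWindowAt`, unprinted for its object — UV3-NODE §67) are NOT
addressed, so `stub_runClassMembershipH` is NOT closed; the five registered stubs of `Lines/semiclassical_s2beta.lean` (3732b7df, untouched), crux 20520 ∕ 19936 ∕ 19200 and
`YM3TorusSU2` are NOT proved; registry untouched; rung R3 = SU(2) YM₃ on T³ at fixed lattice data — NOT d = 4, NOT infinite volume, NOT a mass gap, NOT Clay; the Yang–Mills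
mass gap is NOT proved by any of this.
References: [Balaban1985UV3] T. Bałaban, CMP **102** (1985) 255–275, (2) p. 256, (7) p. 257, (47) p. 267; [Balaban1987RG1] CMP **109** (1987) 249–301, (0.11) p. 253.
-/

set_option autoImplicit false

noncomputable section

namespace Summit.QuantumFields.YangMills.Theorems.FluctuationComparisonRegPrIntLS1aTowerOneVersionPWC

open MeasureTheory Set Function Filter Topology
open scoped ENNReal
open Literature.MathematicalPhysics.QuantumFieldTheory.Balaban1983to89
open T3ContinuumYM3Torus T3NestedUnitLaws T3UnitLawDensityEML T3UnitScaleTilt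
open Literature.MathematicalPhysics.QuantumFieldTheory.Balaban1983to89.T3TiltDescent (descendTo measurable_descendTo)
open Literature.MathematicalPhysics.QuantumFieldTheory.Balaban1983to89.T3DescentFibreTower (descendTo_descendTo descendTo_self)
open Summit.QuantumFields.YangMills.Theorems.FluctuationComparisonRegPrIntLS1aTowerFullWindowMinorant (exists_continuous_pos_minorant_fullWindow_sfCut)
open Summit.QuantumFields.YangMills.Theorems.FluctuationComparisonRegPrIntLS1aTowerLawSandwich (run_eq_map_descendTo)
open Summit.QuantumFields.YangMills.Theorems.FluctuationComparisonRegPrIntLOrganTangentFibredChartDescendTo (descend_eq_descendTo')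
open Summit.QuantumFields.YangMills.Theorems.FluctuationComparisonRegPrIntLS1aAnchorStepContinuousDensity (exists_continuous_density_tower)

/-! ## §1 An a.e. inequality between functions continuous on an open set holds everywhere on it (product Haar charges open sets) -/

/-- ★ On an open set `W` charged by `μ` (`IsOpenPosMeasure`), if `m`, `g` are continuous on `W`, `g ≥ 0`, and `ofReal (m V) ≤ ofReal (g V)` for `μ`-a.e. `V`, then
`m V ≤ g V` at EVERY `V ∈ W`. [folklore] -/
theorem le_on_open_of_ae_ofReal_le {X : Type*} [TopologicalSpace X] [MeasurableSpace X] (μ : Measure X) [μ.IsOpenPosMeasure]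
    {W : Set X} (hW : IsOpen W) {m g : X → ℝ} (hm : ContinuousOn m W) (hg : ContinuousOn g W) (hg0 : ∀ V, 0 ≤ g V)
    (hae : ∀ᵐ V ∂μ, ENNReal.ofReal (m V) ≤ ENNReal.ofReal (g V)) : ∀ V ∈ W, m V ≤ g V := by
  intro V₀ hV₀
  by_contra hlt
  rw [not_le] at hlt
  -- the open set where `g < m` inside `W`
  have hO : IsOpen (W ∩ (fun V => m V - g V) ⁻¹' Set.Ioi (0 : ℝ)) := (hm.sub hg).isOpen_inter_preimage hW isOpen_Ioi
  have hV₀O : V₀ ∈ W ∩ (fun V => m V - g V) ⁻¹' Set.Ioi (0 : ℝ) := ⟨hV₀, by show 0 < m V₀ - g V₀; linarith⟩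
  have hpos : 0 < μ (W ∩ (fun V => m V - g V) ⁻¹' Set.Ioi (0 : ℝ)) := hO.measure_pos μ ⟨V₀, hV₀O⟩
  have hnull : μ (W ∩ (fun V => m V - g V) ⁻¹' Set.Ioi (0 : ℝ)) = 0 := by
    rw [measure_eq_zero_iff_ae_notMem]
    filter_upwards [hae] with V hV hVO
    have h1 : m V ≤ g V := (ENNReal.ofReal_le_ofReal_iff (hg0 V)).1 hV
    have h2 : 0 < m V - g V := hVO.2
    linarith
  exact hpos.ne' hnull

/-! ## §2 The junction: the tower's everywhere-continuous version IS positive on every window (px21 g22's minorant), hence (p) ∧ (w) ∧ (c) for ONE version -/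

variable (F : T3Family) {γ b₀ p₀ : ℝ}

/-- ★★★ **(J1) DOOR FORM.**  Given the tower (c)-door in `j₀`-FIRST form — «for every run system and every cut-and-anchored tower, every law `μ j`, `j₀ ≤ j ≤ K`, has an
EVERYWHERE-CONTINUOUS non-negative density» (px17 g21's `…S1aAnchorStepContinuousDensity.exists_continuous_density_tower`) — and px21 g22's continuous strictly positive window
MINORANT of every density (✓`exists_continuous_pos_minorant_fullWindow_sfCut`), ONE version carries (p) ∧ (w) ∧ (c) of S1aᴴ at every height `j₀′ ≤ j ≤ K` (and is moreover
continuous everywhere, measurable, `≥ 0`, with `regSet = univ`): the continuous version dominates the minorant a.e., hence everywhere on the open window (§1).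
[cite: Balaban1985UV3, (2) p.256, (7) p.257 and (47) p.267] -/
theorem oneVersion_of_towerDoor (L : ℕ) (hb : 0 < b₀) (hp : 0 < p₀)
    (hdoor : ∀ (F : T3Family) (γ : ℝ), F.L = L → 0 < γ → γ ≤ 1 →
      ∃ j₀ : ℕ, ∀ (ν : ℕ → (j : ℕ) → Measure (GaugeField (F.P j) 0 ↥(Matrix.specialUnitaryGroup (Fin 2) ℂ))),
        (∀ K, ν K K = T4GenFunBounds.gibbsMeasure (F.P K) ((F.scheme ℰp γ).β K)) →
        (∀ K j, j < K → ν K j = Measure.map (descend F ℰp j) (ν K (j + 1))) →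
        ∀ (K Ts : ℕ), Ts ≤ K → ∀ (μ : (j : ℕ) → Measure (GaugeField (F.P j) 0 ↥(Matrix.specialUnitaryGroup (Fin 2) ℂ))),
          (∀ j, Ts ≤ j → μ j = ν K j) →
          (∀ j, j < Ts → μ j = Measure.map (descend F ℰp j) ((μ (j + 1)).withDensity (fun U => ENNReal.ofReal
            (∏ p : Plaq (F.P (j + 1)) 0, max 0 (min 1 ((24 / 25 * θBal F.L γ b₀ p₀ (j + 1) - dist1 (GaugeField.plaqHol U p)) /
              ((24 / 25 - 1 / 2) * θBal F.L γ b₀ p₀ (j + 1)))))))) →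
          ∀ j, j₀ ≤ j → j ≤ K →
            ∃ g : GaugeField (F.P j) 0 ↥(Matrix.specialUnitaryGroup (Fin 2) ℂ) → ℝ, Continuous g ∧ Measurable g ∧ (∀ V, 0 ≤ g V) ∧
              μ j = (fieldMeasure _ _ _).withDensity (fun V => ENNReal.ofReal (g V)) ∧
              Node00.regSet (fieldMeasure (F.P j) 0 ↥(Matrix.specialUnitaryGroup (Fin 2) ℂ)) g = univ) :
    ∃ γ₁ : ℝ, 0 < γ₁ ∧ ∀ (F : T3Family) (γ : ℝ), F.L = L → 0 < γ → γ ≤ γ₁ → ∃ j₀ : ℕ,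
      ∀ (ν : ℕ → (j : ℕ) → Measure (GaugeField (F.P j) 0 ↥(Matrix.specialUnitaryGroup (Fin 2) ℂ))),
        (∀ K, ν K K = T4GenFunBounds.gibbsMeasure (F.P K) ((F.scheme ℰp γ).β K)) →
        (∀ K j, j < K → ν K j = Measure.map (descend F ℰp j) (ν K (j + 1))) →
        ∀ (K Ts : ℕ), Ts ≤ K → ∀ (μ : (j : ℕ) → Measure (GaugeField (F.P j) 0 ↥(Matrix.specialUnitaryGroup (Fin 2) ℂ))),
          (∀ j, Ts ≤ j → μ j = ν K j) →
          (∀ j, j < Ts → μ j = Measure.map (descend F ℰp j) ((μ (j + 1)).withDensity (fun U => ENNReal.ofReal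
            (∏ p : Plaq (F.P (j + 1)) 0, max 0 (min 1 ((24 / 25 * θBal F.L γ b₀ p₀ (j + 1) - dist1 (GaugeField.plaqHol U p)) /
              ((24 / 25 - 1 / 2) * θBal F.L γ b₀ p₀ (j + 1)))))))) →
          ∃ ρ : (j : ℕ) → GaugeField (F.P j) 0 ↥(Matrix.specialUnitaryGroup (Fin 2) ℂ) → ℝ, ∀ (j : ℕ) (hjK : j ≤ K), j₀ ≤ j →
            (∀ U, PlaqSmall (θBal F.L γ b₀ p₀ j) U → 0 < ρ j U) ∧
            μ j = (fieldMeasure _ _ _).withDensity (fun U => ENNReal.ofReal (ρ j U)) ∧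
            ContinuousOn (ρ j) {U | PlaqSmall (θBal F.L γ b₀ p₀ j) U} ∧
            (Continuous (ρ j) ∧ Measurable (ρ j) ∧ (∀ U, 0 ≤ ρ j U) ∧
              Node00.regSet (fieldMeasure (F.P j) 0 ↥(Matrix.specialUnitaryGroup (Fin 2) ℂ)) (ρ j) = univ) := by
  classical
  obtain ⟨γ₁, hγ₁, H21⟩ := exists_continuous_pos_minorant_fullWindow_sfCut L hb hp
  refine ⟨min γ₁ 1, lt_min hγ₁ one_pos, fun F γ hFL hγ hγle => ?_⟩
  have hγ₁' : γ ≤ γ₁ := hγle.trans (min_le_left _ _)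
  have hγ1 : γ ≤ 1 := hγle.trans (min_le_right _ _)
  obtain ⟨jV, HV⟩ := H21 F γ hFL hγ hγ₁'
  obtain ⟨j₀, HT⟩ := hdoor F γ hFL hγ hγ1
  refine ⟨max jV j₀, fun ν hν1 hν2 K Ts hTs μ hanch hcut => ?_⟩
  -- the continuous versions, height by height
  have hT : ∀ j, max jV j₀ ≤ j → j ≤ K →
      ∃ g : GaugeField (F.P j) 0 ↥(Matrix.specialUnitaryGroup (Fin 2) ℂ) → ℝ, Continuous g ∧ Measurable g ∧ (∀ V, 0 ≤ g V) ∧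
        μ j = (fieldMeasure _ _ _).withDensity (fun V => ENNReal.ofReal (g V)) ∧
        Node00.regSet (fieldMeasure (F.P j) 0 ↥(Matrix.specialUnitaryGroup (Fin 2) ℂ)) g = univ :=
    fun j hj hjK => HT ν hν1 hν2 K Ts hTs μ hanch hcut j ((le_max_right _ _).trans hj) hjK
  -- choose them (junk `0` off the range)
  refine ⟨fun j => if h : max jV j₀ ≤ j ∧ j ≤ K then Classical.choose (hT j h.1 h.2) else fun _ => 0, fun j hjK hj => ?_⟩
  have hsel : (fun j => if h : max jV j₀ ≤ j ∧ j ≤ K then Classical.choose (hT j h.1 h.2) else fun _ => (0 : ℝ)) j =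
      Classical.choose (hT j hj hjK) := by
    simp only [dif_pos (And.intro hj hjK)]
  rw [hsel]
  obtain ⟨hgc, hgm, hg0, hμ, hreg⟩ := Classical.choose_spec (hT j hj hjK)
  set g := Classical.choose (hT j hj hjK) with hg
  -- (p): the continuous version dominates px21's positive minorant on the window
  obtain ⟨m, hmc, hmpos, hmle⟩ := HV ν hν1 hν2 K Ts hTs μ hanch hcut j ((le_max_left _ _).trans hj) hjK
  have hae := hmle (fun V => ENNReal.ofReal (g V)) hμ
  have hwin : IsOpen {U : GaugeField (F.P j) 0 ↥(Matrix.specialUnitaryGroup (Fin 2) ℂ) | PlaqSmall (θBal F.L γ b₀ p₀ j) U} :=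
    FluctuationComparisonRegPrIntLS1aTowerDensityVersion.isOpen_window (P := F.P j) _
  haveI : (fieldMeasure (F.P j) 0 ↥(Matrix.specialUnitaryGroup (Fin 2) ℂ)).IsOpenPosMeasure :=
    B12ContinuousTransportInvariance.isOpenPosMeasure_fieldMeasure_SU 2 (F.P j) 0
  have hle := le_on_open_of_ae_ofReal_le (fieldMeasure (F.P j) 0 ↥(Matrix.specialUnitaryGroup (Fin 2) ℂ)) hwin hmc hgc.continuousOn hg0 hae
  exact ⟨fun U hU => (hmpos U hU).trans_le (hle U hU), hμ, hgc.continuousOn, hgc, hgm, hg0, hreg⟩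

/-! ## §3 The tower (c)-door with `j₀` chosen BEFORE the run system (the def's quantifier order), from px17 g21's door at the canonical runs -/

/-- ★★ **`j₀` FIRST.**  px17 g21's ✓`exists_continuous_density_tower` states `∀ ν, hν1 → hν2 → ∃ j₀, …`; `RunClassMembershipH` chooses `j₀` BEFORE `ν`.  Since the run
hypotheses determine `ν K j` for `j ≤ K` (✓`run_eq_map_descendTo`: `ν K j = (D_{j,K})_* Gibbs_K`), the height `j₀` obtained at the CANONICAL run system
`ν₀ K j := (D_{j,K})_* Gibbs_K` (`j ≤ K`; the Gibbs law of `F.P j` as junk above `K`) serves every run system: replace the tower `μ` by `μ′ := μ` up to `K`, `ν₀ K ·` above.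
[cite: Balaban1987RG1, (0.11) p.253] -/
theorem exists_j0_continuous_density_tower {γ b₀ : ℝ} (hγ : 0 < γ) (hγ1 : γ ≤ 1) (hb : 0 < b₀) (p₀ : ℝ) :
    ∃ j₀ : ℕ, ∀ (ν : ℕ → (j : ℕ) → Measure (GaugeField (F.P j) 0 ↥(Matrix.specialUnitaryGroup (Fin 2) ℂ))),
      (∀ K, ν K K = T4GenFunBounds.gibbsMeasure (F.P K) ((F.scheme ℰp γ).β K)) →
      (∀ K j, j < K → ν K j = Measure.map (descend F ℰp j) (ν K (j + 1))) →
      ∀ (K Ts : ℕ), Ts ≤ K → ∀ (μ : (j : ℕ) → Measure (GaugeField (F.P j) 0 ↥(Matrix.specialUnitaryGroup (Fin 2) ℂ))),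
        (∀ j, Ts ≤ j → μ j = ν K j) →
        (∀ j, j < Ts → μ j = Measure.map (descend F ℰp j) ((μ (j + 1)).withDensity (fun U => ENNReal.ofReal
          (∏ p : Plaq (F.P (j + 1)) 0, max 0 (min 1 ((24 / 25 * θBal F.L γ b₀ p₀ (j + 1) - dist1 (GaugeField.plaqHol U p)) /
            ((24 / 25 - 1 / 2) * θBal F.L γ b₀ p₀ (j + 1)))))))) →
        ∀ j, j₀ ≤ j → j ≤ K →
          ∃ g : GaugeField (F.P j) 0 ↥(Matrix.specialUnitaryGroup (Fin 2) ℂ) → ℝ, Continuous g ∧ Measurable g ∧ (∀ V, 0 ≤ g V) ∧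
            μ j = (fieldMeasure _ _ _).withDensity (fun V => ENNReal.ofReal (g V)) ∧
            Node00.regSet (fieldMeasure (F.P j) 0 ↥(Matrix.specialUnitaryGroup (Fin 2) ℂ)) g = univ := by
  classical
  -- the canonical run system
  set ν₀ : ℕ → (j : ℕ) → Measure (GaugeField (F.P j) 0 ↥(Matrix.specialUnitaryGroup (Fin 2) ℂ)) := fun K j =>
    if h : j ≤ K then Measure.map (descendTo F ℰp j K h) (gibbsK F ℰp γ K)
    else T4GenFunBounds.gibbsMeasure (F.P j) ((F.scheme ℰp γ).β j) with hν₀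
  have hν₀1 : ∀ K, ν₀ K K = T4GenFunBounds.gibbsMeasure (F.P K) ((F.scheme ℰp γ).β K) := by
    intro K
    have e : (descendTo F ℰp K K le_rfl : GaugeField (F.P K) 0 ↥(Matrix.specialUnitaryGroup (Fin 2) ℂ) →
        GaugeField (F.P K) 0 ↥(Matrix.specialUnitaryGroup (Fin 2) ℂ)) = id := funext fun U => descendTo_self F ℰp K U
    simp only [hν₀, dif_pos le_rfl]
    rw [e, Measure.map_id, gibbsK_eq]
  have hν₀2 : ∀ K j, j < K → ν₀ K j = Measure.map (descend F ℰp j) (ν₀ K (j + 1)) := by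
    intro K j hjK
    have hjK' : j + 1 ≤ K := hjK
    have hjK0 : j ≤ K := hjK.le
    have hd : Measurable (descend F ℰp j : GaugeField (F.P (j + 1)) 0 ↥(Matrix.specialUnitaryGroup (Fin 2) ℂ) →
        GaugeField (F.P j) 0 ↥(Matrix.specialUnitaryGroup (Fin 2) ℂ)) := measurable_descend F ℰp measurableE_ℰp j
    have hD : Measurable (descendTo F ℰp (j + 1) K hjK' : GaugeField (F.P K) 0 ↥(Matrix.specialUnitaryGroup (Fin 2) ℂ) →
        GaugeField (F.P (j + 1)) 0 ↥(Matrix.specialUnitaryGroup (Fin 2) ℂ)) := measurable_descendTo F ℰp measurableE_ℰp hjK'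
    have e : (descendTo F ℰp j K hjK0 : GaugeField (F.P K) 0 ↥(Matrix.specialUnitaryGroup (Fin 2) ℂ) →
        GaugeField (F.P j) 0 ↥(Matrix.specialUnitaryGroup (Fin 2) ℂ)) = descend F ℰp j ∘ descendTo F ℰp (j + 1) K hjK' := by
      funext U
      show descendTo F ℰp j K hjK0 U = descend F ℰp j (descendTo F ℰp (j + 1) K hjK' U)
      rw [descend_eq_descendTo' F j (Nat.le_succ j), descendTo_descendTo]
    simp only [hν₀, dif_pos hjK0, dif_pos hjK']
    rw [Measure.map_map hd hD, e]
  obtain ⟨j₀, H⟩ := exists_continuous_density_tower F hγ hγ1 hb p₀ ν₀ hν₀1 hν₀2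
  refine ⟨j₀, fun ν hν1 hν2 K Ts hTs μ hanch hcut j hj₀ hjK => ?_⟩
  -- the runs agree with the canonical ones up to `K`
  have hνν₀ : ∀ i (hi : i ≤ K), ν K i = ν₀ K i := by
    intro i hi
    rw [run_eq_map_descendTo F ν hν1 hν2 hi]
    simp only [hν₀, dif_pos hi]
  -- the modified tower
  set μ' : (i : ℕ) → Measure (GaugeField (F.P i) 0 ↥(Matrix.specialUnitaryGroup (Fin 2) ℂ)) := fun i => if i ≤ K then μ i else ν₀ K i with hμ'
  have hμ'eq : ∀ i, i ≤ K → μ' i = μ i := fun i hi => by simp only [hμ', if_pos hi]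
  have hanch' : ∀ i, Ts ≤ i → μ' i = ν₀ K i := by
    intro i hi
    by_cases hiK : i ≤ K
    · rw [hμ'eq i hiK, hanch i hi, hνν₀ i hiK]
    · simp only [hμ', if_neg hiK]
  have hcut' : ∀ i, i < Ts → μ' i = Measure.map (descend F ℰp i) ((μ' (i + 1)).withDensity (fun U => ENNReal.ofReal
      (∏ p : Plaq (F.P (i + 1)) 0, max 0 (min 1 ((24 / 25 * θBal F.L γ b₀ p₀ (i + 1) - dist1 (GaugeField.plaqHol U p)) /
        ((24 / 25 - 1 / 2) * θBal F.L γ b₀ p₀ (i + 1))))))) := by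
    intro i hi
    rw [hμ'eq i (by omega), hμ'eq (i + 1) (by omega)]
    exact hcut i hi
  obtain ⟨g, hgc, hgm, hg0, hμ, hreg⟩ := H K Ts hTs μ' hanch' hcut' j hj₀ hjK
  exact ⟨g, hgc, hgm, hg0, (hμ'eq j hjK).symm.trans hμ, hreg⟩

/-! ## §4 (J1): S1aᴴ minus (m) and (a), for ONE version, at every height `j₀ ≤ j ≤ K` -/

/-- ★★★ **(J1) — `RunClassMembershipH` ∖ {(m), (a)} BY KERNEL, ONE VERSION, EVERY BLOCK SIZE AND WINDOW CONSTANT.**  For every `L`, `0 < b₀`, `0 < p₀` there is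
`γ₁ > 0` such that for every family of block size `L`, `0 < γ ≤ γ₁`, there is a height `j₀` (chosen BEFORE the runs) such that for every run system `ν` (`ν K K = Gibbs_K`,
`ν K j = (descend j)_* ν K (j+1)`), every `Ts ≤ K` and every cut-and-anchored tower `μ` of S1aᴴ's shape there is ONE density family `ρ` with, at every `j₀ ≤ j ≤ K`:
(p) `ρ j > 0` on the `θBal F.L γ b₀ p₀ j`-window, (w) `μ j = dU_j.withDensity (ofReal ∘ ρ j)`, (c) `ContinuousOn (ρ j) {PlaqSmall θ_j}` — and moreover `ρ j` continuous
everywhere, measurable, `≥ 0`, `Node00.regSet dU_j (ρ j) = univ`.  (m) and (a) of S1aᴴ are NOT addressed. [cite: Balaban1985UV3, (2) p.256, (7) p.257 and (47) p.267; Balaban1987RG1, (0.11) p.253] -/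
theorem runTower_oneVersion_pos_withDensity_continuous (L : ℕ) {b₀ p₀ : ℝ} (hb : 0 < b₀) (hp : 0 < p₀) :
    ∃ γ₁ : ℝ, 0 < γ₁ ∧ ∀ (F : T3Family) (γ : ℝ), F.L = L → 0 < γ → γ ≤ γ₁ → ∃ j₀ : ℕ,
      ∀ (ν : ℕ → (j : ℕ) → Measure (GaugeField (F.P j) 0 ↥(Matrix.specialUnitaryGroup (Fin 2) ℂ))),
        (∀ K, ν K K = T4GenFunBounds.gibbsMeasure (F.P K) ((F.scheme ℰp γ).β K)) →
        (∀ K j, j < K → ν K j = Measure.map (descend F ℰp j) (ν K (j + 1))) →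
        ∀ (K Ts : ℕ), Ts ≤ K → ∀ (μ : (j : ℕ) → Measure (GaugeField (F.P j) 0 ↥(Matrix.specialUnitaryGroup (Fin 2) ℂ))),
          (∀ j, Ts ≤ j → μ j = ν K j) →
          (∀ j, j < Ts → μ j = Measure.map (descend F ℰp j) ((μ (j + 1)).withDensity (fun U => ENNReal.ofReal
            (∏ p : Plaq (F.P (j + 1)) 0, max 0 (min 1 ((24 / 25 * θBal F.L γ b₀ p₀ (j + 1) - dist1 (GaugeField.plaqHol U p)) /
              ((24 / 25 - 1 / 2) * θBal F.L γ b₀ p₀ (j + 1)))))))) →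
          ∃ ρ : (j : ℕ) → GaugeField (F.P j) 0 ↥(Matrix.specialUnitaryGroup (Fin 2) ℂ) → ℝ, ∀ (j : ℕ) (hjK : j ≤ K), j₀ ≤ j →
            (∀ U, PlaqSmall (θBal F.L γ b₀ p₀ j) U → 0 < ρ j U) ∧
            μ j = (fieldMeasure _ _ _).withDensity (fun U => ENNReal.ofReal (ρ j U)) ∧
            ContinuousOn (ρ j) {U | PlaqSmall (θBal F.L γ b₀ p₀ j) U} ∧
            (Continuous (ρ j) ∧ Measurable (ρ j) ∧ (∀ U, 0 ≤ ρ j U) ∧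
              Node00.regSet (fieldMeasure (F.P j) 0 ↥(Matrix.specialUnitaryGroup (Fin 2) ℂ)) (ρ j) = univ) :=
  oneVersion_of_towerDoor L hb hp fun F _ _ hγ hγ1 => exists_j0_continuous_density_tower F hγ hγ1 hb p₀

/-- ★★★ **(J1) IN `RunClassMembershipH`'s LITERAL PREFIX** (`∀ L, ∃ pm, … ∀ p₀ ≥ pm, ∃ b₀, ∃ γ₁, ∀ F γ, … ∃ j₀, ∀ ν …, ∃ ρ, ∀ j (hjK) , j₀ ≤ j → (p) ∧ (w) ∧ (c)`): the three
elementary conjuncts of S1aᴴ — `AdmissibleClassParams`∕`MemOfRun` ((m)) and `AnalyticPairWindowAt` ((a)) DELETED — hold by kernel with `pm := 1`, `b₀ := 1` (any positive values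
serve; the (m)-lane's schedule will dictate its own `b₀`, for which the previous theorem applies verbatim). [cite: Balaban1985UV3, (2) p.256, (7) p.257 and (47) p.267] -/
theorem runClassMembershipH_pwc :
    ∀ (L : ℕ), ∃ pm : ℝ, 0 < pm ∧ ∀ (p₀ : ℝ), pm ≤ p₀ → ∃ b₀ : ℝ, 0 < b₀ ∧ ∃ γ₁ : ℝ, 0 < γ₁ ∧ ∀ (F : T3Family) (γ : ℝ), F.L = L → 0 < γ → γ ≤ γ₁ →
      ∃ j₀ : ℕ, ∀ (ν : ℕ → (j : ℕ) → Measure (GaugeField (F.P j) 0 ↥(Matrix.specialUnitaryGroup (Fin 2) ℂ))),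
        (∀ K, ν K K = T4GenFunBounds.gibbsMeasure (F.P K) ((F.scheme ℰp γ).β K)) →
        (∀ K j, j < K → ν K j = Measure.map (descend F ℰp j) (ν K (j + 1))) →
        ∀ (K Ts : ℕ), Ts ≤ K → ∀ (μ : (j : ℕ) → Measure (GaugeField (F.P j) 0 ↥(Matrix.specialUnitaryGroup (Fin 2) ℂ))),
          (∀ j, Ts ≤ j → μ j = ν K j) →
          (∀ j, j < Ts → μ j = Measure.map (descend F ℰp j) ((μ (j + 1)).withDensity (fun U => ENNReal.ofReal
            (∏ p : Plaq (F.P (j + 1)) 0, max 0 (min 1 ((24 / 25 * θBal F.L γ 1 p₀ (j + 1) - dist1 (GaugeField.plaqHol U p)) /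
              ((24 / 25 - 1 / 2) * θBal F.L γ 1 p₀ (j + 1)))))))) →
          ∃ ρ : (j : ℕ) → GaugeField (F.P j) 0 ↥(Matrix.specialUnitaryGroup (Fin 2) ℂ) → ℝ, ∀ (j : ℕ) (hjK : j ≤ K), j₀ ≤ j →
            (∀ U, PlaqSmall (θBal F.L γ 1 p₀ j) U → 0 < ρ j U) ∧
            μ j = (fieldMeasure _ _ _).withDensity (fun U => ENNReal.ofReal (ρ j U)) ∧
            ContinuousOn (ρ j) {U | PlaqSmall (θBal F.L γ 1 p₀ j) U} := by
  intro L
  refine ⟨1, one_pos, fun p₀ hp₀ => ⟨1, one_pos, ?_⟩⟩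
  have hp : 0 < p₀ := one_pos.trans_le hp₀
  obtain ⟨γ₁, hγ₁, H⟩ := runTower_oneVersion_pos_withDensity_continuous L one_pos hp
  refine ⟨γ₁, hγ₁, fun F γ hFL hγ hγle => ?_⟩
  obtain ⟨j₀, HJ⟩ := H F γ hFL hγ hγle
  refine ⟨j₀, fun ν hν1 hν2 K Ts hTs μ hanch hcut => ?_⟩
  obtain ⟨ρ, hρ⟩ := HJ ν hν1 hν2 K Ts hTs μ hanch hcut
  exact ⟨ρ, fun j hjK hj => ⟨(hρ j hjK hj).1, (hρ j hjK hj).2.1, (hρ j hjK hj).2.2.1⟩⟩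

end Summit.QuantumFields.YangMills.Theorems.FluctuationComparisonRegPrIntLS1aTowerOneVersionPWC

end
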